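import Summits.CriticalPhenomena.PercolationContinuityZ3.Theorems.PercNearOneGluingNoHeavyLowerTailSunflowerVertexFibresWA
import Summits.CriticalPhenomena.PercolationContinuityZ3.Theorems.PercNearOneGluingNoHeavyLowerTailSunflowerVertexFibresWB
import Summits.CriticalPhenomena.PercolationContinuityZ3.Theorems.PercNearOneGluingNoHeavyLowerTailSunflowerPowerCertificate

/-!
# (RES0′) FOR EVERY NUMBER OF PETALS FROM A FINITE VERTEX CRITERION, W PRICED — seven budgets, 13 vertices + 3 convexity rows

(prove-1 gen 57, memo run/shared/lean/prim/prim-ineq-prove-1/FINDING-VERTEX-prove1-g57.md §3.)  As `…SunflowerVertexCertificate`, with the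
face `W = {w=1}` priced as a seventh budget (`u_W = ((1−τ)H + τ(σ + (1−σ)k))/w_f`).  W is root-ordered on every fibre except the `y = k` edges
`(t,t,α₀₁,α₁₁)`, `(t,t,α₀₁,1)`, `(t,t,α₁₁,α₁₁)`, where its usage has the slope of `G` and a larger intercept; there the defect is convex in
`log t` under ONE linear inequality per edge, `λ_W·a_W·(A + τ(1−σ))² ≤ A·(a_W + τ(1−σ))²` with `A = c₀ + s(1−τ)H_c`, `a_W = (1−τ)H_c + τσ`,
`H_c = (1−σ)c + σh` (`affine_le_prod7_yk_of_endpoints`).  **`vertex_one_petal_W`**: the thirteen vertex inequalities + the three rows ⟹ the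
seven-budget certificate inequality for every petal; **`res0_of_vertex_certificate_W`**: + the cap condition ⟹ `∏ G_j ≤ g^(n−1)·a` for every
nonempty family obeying the seven budgets (cells `y,k,g,h`, faces Ȳ, H, W).  Numerically this 17-row LP in `λ ∈ ℝ⁷` is feasible at 99.2 % of random
parameter points (six budgets: 97.9 %; memo §2–§3). [this work]
-/

namespace Summit.CriticalPhenomena.PercolationContinuityZ3.Theorems.SunflowerPartition.SafeCalc.LinkedCurrency

open Finset

section VertexAssemblyW
variable {τ σ s α00 α01 α11 c0 g ly lk lg lh lX lH lW : ℝ}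
/- Parameters / exponents / `g` (as in the fibre files). -/
variable (hP : 0 < τ ∧ τ < 1 ∧ 0 < σ ∧ σ < 1 ∧ 0 < s ∧ s < 1 ∧ 0 < α00 ∧ α00 ≤ α01 ∧ α01 ≤ α11 ∧ α11 ≤ 1 ∧
      τ * σ + (1 - τ) * (1 - s) * α00 ≤ c0 ∧ 0 ≤ ly ∧ 0 ≤ lk ∧ 0 ≤ lg ∧ 0 ≤ lh ∧ 0 ≤ lX ∧ 0 ≤ lH ∧ 0 ≤ lW ∧
      g = (c0 + τ * (1 - σ) * ((1 - s) * α00 + s * α01) + s * (1 - τ) * ((1 - σ) * α01 + σ * α11)))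
/- The THIRTEEN vertex inequalities (h-petal, Da, Da+h, k-hubs `(α₀₀,1,α₀₁,·)`, x-hubs `(1,1,α₀₁,·)`, Db, Dc, H-hub, `(α₀₀,1,α₁₁,α₁₁)`,
`(1,1,α₁₁,α₁₁)`, full). -/
variable (hX : (c0 + τ * (1 - σ) * ((1 - s) * α00 + s * α01) + s * (1 - τ) * ((1 - σ) * α01 + σ * 1)) ≤ g * (α00 / α00) ^ ly * (α01 / α01) ^ lk * (α01 / α01) ^ lg * (1 / α11) ^ lh * (((1 - s) * α00 + s * α01) / ((1 - s) * α00 + s * α01)) ^ lX * (((1 - σ) * α01 + σ * 1) / ((1 - σ) * α01 + σ * α11)) ^ lH * (((1 - τ) * ((1 - σ) * α01 + σ * 1) + τ * (σ + (1 - σ) * α01)) / ((1 - τ) * ((1 - σ) * α01 + σ * α11) + τ * (σ + (1 - σ) * α01))) ^ lW ∧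
      (c0 + τ * (1 - σ) * ((1 - s) * α01 + s * α01) + s * (1 - τ) * ((1 - σ) * α01 + σ * α11)) ≤ g * (α01 / α00) ^ ly * (α01 / α01) ^ lk * (α01 / α01) ^ lg * (α11 / α11) ^ lh * (((1 - s) * α01 + s * α01) / ((1 - s) * α00 + s * α01)) ^ lX * (((1 - σ) * α01 + σ * α11) / ((1 - σ) * α01 + σ * α11)) ^ lH * (((1 - τ) * ((1 - σ) * α01 + σ * α11) + τ * (σ + (1 - σ) * α01)) / ((1 - τ) * ((1 - σ) * α01 + σ * α11) + τ * (σ + (1 - σ) * α01))) ^ lW ∧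
      (c0 + τ * (1 - σ) * ((1 - s) * α01 + s * α01) + s * (1 - τ) * ((1 - σ) * α01 + σ * 1)) ≤ g * (α01 / α00) ^ ly * (α01 / α01) ^ lk * (α01 / α01) ^ lg * (1 / α11) ^ lh * (((1 - s) * α01 + s * α01) / ((1 - s) * α00 + s * α01)) ^ lX * (((1 - σ) * α01 + σ * 1) / ((1 - σ) * α01 + σ * α11)) ^ lH * (((1 - τ) * ((1 - σ) * α01 + σ * 1) + τ * (σ + (1 - σ) * α01)) / ((1 - τ) * ((1 - σ) * α01 + σ * α11) + τ * (σ + (1 - σ) * α01))) ^ lW ∧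
      (c0 + τ * (1 - σ) * ((1 - s) * α00 + s * 1) + s * (1 - τ) * ((1 - σ) * α01 + σ * α11)) ≤ g * (α00 / α00) ^ ly * (1 / α01) ^ lk * (α01 / α01) ^ lg * (α11 / α11) ^ lh * (((1 - s) * α00 + s * 1) / ((1 - s) * α00 + s * α01)) ^ lX * (((1 - σ) * α01 + σ * α11) / ((1 - σ) * α01 + σ * α11)) ^ lH * (((1 - τ) * ((1 - σ) * α01 + σ * α11) + τ * (σ + (1 - σ) * 1)) / ((1 - τ) * ((1 - σ) * α01 + σ * α11) + τ * (σ + (1 - σ) * α01))) ^ lW ∧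
      (c0 + τ * (1 - σ) * ((1 - s) * α00 + s * 1) + s * (1 - τ) * ((1 - σ) * α01 + σ * 1)) ≤ g * (α00 / α00) ^ ly * (1 / α01) ^ lk * (α01 / α01) ^ lg * (1 / α11) ^ lh * (((1 - s) * α00 + s * 1) / ((1 - s) * α00 + s * α01)) ^ lX * (((1 - σ) * α01 + σ * 1) / ((1 - σ) * α01 + σ * α11)) ^ lH * (((1 - τ) * ((1 - σ) * α01 + σ * 1) + τ * (σ + (1 - σ) * 1)) / ((1 - τ) * ((1 - σ) * α01 + σ * α11) + τ * (σ + (1 - σ) * α01))) ^ lW ∧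
      (c0 + τ * (1 - σ) * ((1 - s) * 1 + s * 1) + s * (1 - τ) * ((1 - σ) * α01 + σ * α11)) ≤ g * (1 / α00) ^ ly * (1 / α01) ^ lk * (α01 / α01) ^ lg * (α11 / α11) ^ lh * (((1 - s) * 1 + s * 1) / ((1 - s) * α00 + s * α01)) ^ lX * (((1 - σ) * α01 + σ * α11) / ((1 - σ) * α01 + σ * α11)) ^ lH * (((1 - τ) * ((1 - σ) * α01 + σ * α11) + τ * (σ + (1 - σ) * 1)) / ((1 - τ) * ((1 - σ) * α01 + σ * α11) + τ * (σ + (1 - σ) * α01))) ^ lW ∧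
      (c0 + τ * (1 - σ) * ((1 - s) * 1 + s * 1) + s * (1 - τ) * ((1 - σ) * α01 + σ * 1)) ≤ g * (1 / α00) ^ ly * (1 / α01) ^ lk * (α01 / α01) ^ lg * (1 / α11) ^ lh * (((1 - s) * 1 + s * 1) / ((1 - s) * α00 + s * α01)) ^ lX * (((1 - σ) * α01 + σ * 1) / ((1 - σ) * α01 + σ * α11)) ^ lH * (((1 - τ) * ((1 - σ) * α01 + σ * 1) + τ * (σ + (1 - σ) * 1)) / ((1 - τ) * ((1 - σ) * α01 + σ * α11) + τ * (σ + (1 - σ) * α01))) ^ lW ∧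
      (c0 + τ * (1 - σ) * ((1 - s) * α00 + s * α11) + s * (1 - τ) * ((1 - σ) * α11 + σ * α11)) ≤ g * (α00 / α00) ^ ly * (α11 / α01) ^ lk * (α11 / α01) ^ lg * (α11 / α11) ^ lh * (((1 - s) * α00 + s * α11) / ((1 - s) * α00 + s * α01)) ^ lX * (((1 - σ) * α11 + σ * α11) / ((1 - σ) * α01 + σ * α11)) ^ lH * (((1 - τ) * ((1 - σ) * α11 + σ * α11) + τ * (σ + (1 - σ) * α11)) / ((1 - τ) * ((1 - σ) * α01 + σ * α11) + τ * (σ + (1 - σ) * α01))) ^ lW ∧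
      (c0 + τ * (1 - σ) * ((1 - s) * α11 + s * α11) + s * (1 - τ) * ((1 - σ) * α11 + σ * α11)) ≤ g * (α11 / α00) ^ ly * (α11 / α01) ^ lk * (α11 / α01) ^ lg * (α11 / α11) ^ lh * (((1 - s) * α11 + s * α11) / ((1 - s) * α00 + s * α01)) ^ lX * (((1 - σ) * α11 + σ * α11) / ((1 - σ) * α01 + σ * α11)) ^ lH * (((1 - τ) * ((1 - σ) * α11 + σ * α11) + τ * (σ + (1 - σ) * α11)) / ((1 - τ) * ((1 - σ) * α01 + σ * α11) + τ * (σ + (1 - σ) * α01))) ^ lW ∧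
      (c0 + τ * (1 - σ) * ((1 - s) * α00 + s * 1) + s * (1 - τ) * ((1 - σ) * 1 + σ * 1)) ≤ g * (α00 / α00) ^ ly * (1 / α01) ^ lk * (1 / α01) ^ lg * (1 / α11) ^ lh * (((1 - s) * α00 + s * 1) / ((1 - s) * α00 + s * α01)) ^ lX * (((1 - σ) * 1 + σ * 1) / ((1 - σ) * α01 + σ * α11)) ^ lH * (((1 - τ) * ((1 - σ) * 1 + σ * 1) + τ * (σ + (1 - σ) * 1)) / ((1 - τ) * ((1 - σ) * α01 + σ * α11) + τ * (σ + (1 - σ) * α01))) ^ lW ∧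
      (c0 + τ * (1 - σ) * ((1 - s) * α00 + s * 1) + s * (1 - τ) * ((1 - σ) * α11 + σ * α11)) ≤ g * (α00 / α00) ^ ly * (1 / α01) ^ lk * (α11 / α01) ^ lg * (α11 / α11) ^ lh * (((1 - s) * α00 + s * 1) / ((1 - s) * α00 + s * α01)) ^ lX * (((1 - σ) * α11 + σ * α11) / ((1 - σ) * α01 + σ * α11)) ^ lH * (((1 - τ) * ((1 - σ) * α11 + σ * α11) + τ * (σ + (1 - σ) * 1)) / ((1 - τ) * ((1 - σ) * α01 + σ * α11) + τ * (σ + (1 - σ) * α01))) ^ lW ∧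
      (c0 + τ * (1 - σ) * ((1 - s) * 1 + s * 1) + s * (1 - τ) * ((1 - σ) * α11 + σ * α11)) ≤ g * (1 / α00) ^ ly * (1 / α01) ^ lk * (α11 / α01) ^ lg * (α11 / α11) ^ lh * (((1 - s) * 1 + s * 1) / ((1 - s) * α00 + s * α01)) ^ lX * (((1 - σ) * α11 + σ * α11) / ((1 - σ) * α01 + σ * α11)) ^ lH * (((1 - τ) * ((1 - σ) * α11 + σ * α11) + τ * (σ + (1 - σ) * 1)) / ((1 - τ) * ((1 - σ) * α01 + σ * α11) + τ * (σ + (1 - σ) * α01))) ^ lW ∧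
      (c0 + τ * (1 - σ) * ((1 - s) * 1 + s * 1) + s * (1 - τ) * ((1 - σ) * 1 + σ * 1)) ≤ g * (1 / α00) ^ ly * (1 / α01) ^ lk * (1 / α01) ^ lg * (1 / α11) ^ lh * (((1 - s) * 1 + s * 1) / ((1 - s) * α00 + s * α01)) ^ lX * (((1 - σ) * 1 + σ * 1) / ((1 - σ) * α01 + σ * α11)) ^ lH * (((1 - τ) * ((1 - σ) * 1 + σ * 1) + τ * (σ + (1 - σ) * 1)) / ((1 - τ) * ((1 - σ) * α01 + σ * α11) + τ * (σ + (1 - σ) * α01))) ^ lW)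
include hP

/-- The floor petal satisfies the certificate with equality. [this work] -/
theorem vtxW_floor : (c0 + τ * (1 - σ) * ((1 - s) * α00 + s * α01) + s * (1 - τ) * ((1 - σ) * α01 + σ * α11)) ≤ g * (α00 / α00) ^ ly * (α01 / α01) ^ lk * (α01 / α01) ^ lg * (α11 / α11) ^ lh * (((1 - s) * α00 + s * α01) / ((1 - s) * α00 + s * α01)) ^ lX * (((1 - σ) * α01 + σ * α11) / ((1 - σ) * α01 + σ * α11)) ^ lH * (((1 - τ) * ((1 - σ) * α01 + σ * α11) + τ * (σ + (1 - σ) * α01)) / ((1 - τ) * ((1 - σ) * α01 + σ * α11) + τ * (σ + (1 - σ) * α01))) ^ lW := by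
  obtain ⟨hτ0, hτ1, hσ0, hσ1, hs0, hs1, hα00, h01, h11, hα1, hc0, hly, hlk, hlg, hlh, hlX, hlH, hlW, hg⟩ := id hP
  have hα01 : 0 < α01 := lt_of_lt_of_le hα00 h01
  have hα11 : 0 < α11 := lt_of_lt_of_le hα01 h11
  have h1σ : 0 < 1 - σ := sub_pos.2 hσ1
  have h1s : 0 < 1 - s := sub_pos.2 hs1
  have hbY : 0 < ((1 - s) * α00 + s * α01) := add_pos (mul_pos h1s hα00) (mul_pos hs0 hα01)
  have hbH : 0 < ((1 - σ) * α01 + σ * α11) := add_pos (mul_pos h1σ hα01) (mul_pos hσ0 hα11)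
  have hwf : 0 < ((1 - τ) * ((1 - σ) * α01 + σ * α11) + τ * (σ + (1 - σ) * α01)) := add_pos (mul_pos (sub_pos.2 hτ1) hbH) (mul_pos hτ0 (add_pos_of_pos_of_nonneg hσ0 (mul_nonneg h1σ.le hα01.le)))
  rw [div_self (ne_of_gt hα00), div_self (ne_of_gt hα01), div_self (ne_of_gt hα11), div_self (ne_of_gt hbY), div_self (ne_of_gt hbH),
    div_self (ne_of_gt hwf), Real.one_rpow, Real.one_rpow, Real.one_rpow, Real.one_rpow, Real.one_rpow, Real.one_rpow, Real.one_rpow, ← hg]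
  simp only [mul_one, le_refl]

/-- The facet `g = α₀₁` at a fixed `h₀`: from the four vertices `(α₀₀,α₀₁,α₀₁,h₀)`, `(α₀₁,α₀₁,α₀₁,h₀)`, `(α₀₀,1,α₀₁,h₀)`, `(1,1,α₀₁,h₀)`
to every `(y,k,α₀₁,h₀)` (fibres `y`, `y = k`, then `k`). [this work] -/
theorem vtxW_sq : ∀ h0 : ℝ, α11 ≤ h0 → h0 ≤ 1 →
    lW * ((1 - τ) * ((1 - σ) * α01 + σ * h0) + τ * σ) * ((c0 + s * (1 - τ) * ((1 - σ) * α01 + σ * h0)) + τ * (1 - σ)) ^ 2 ≤ (c0 + s * (1 - τ) * ((1 - σ) * α01 + σ * h0)) * (((1 - τ) * ((1 - σ) * α01 + σ * h0) + τ * σ) + τ * (1 - σ)) ^ 2 →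
    (c0 + τ * (1 - σ) * ((1 - s) * α00 + s * α01) + s * (1 - τ) * ((1 - σ) * α01 + σ * h0)) ≤ g * (α00 / α00) ^ ly * (α01 / α01) ^ lk * (α01 / α01) ^ lg * (h0 / α11) ^ lh * (((1 - s) * α00 + s * α01) / ((1 - s) * α00 + s * α01)) ^ lX * (((1 - σ) * α01 + σ * h0) / ((1 - σ) * α01 + σ * α11)) ^ lH * (((1 - τ) * ((1 - σ) * α01 + σ * h0) + τ * (σ + (1 - σ) * α01)) / ((1 - τ) * ((1 - σ) * α01 + σ * α11) + τ * (σ + (1 - σ) * α01))) ^ lW →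
    (c0 + τ * (1 - σ) * ((1 - s) * α01 + s * α01) + s * (1 - τ) * ((1 - σ) * α01 + σ * h0)) ≤ g * (α01 / α00) ^ ly * (α01 / α01) ^ lk * (α01 / α01) ^ lg * (h0 / α11) ^ lh * (((1 - s) * α01 + s * α01) / ((1 - s) * α00 + s * α01)) ^ lX * (((1 - σ) * α01 + σ * h0) / ((1 - σ) * α01 + σ * α11)) ^ lH * (((1 - τ) * ((1 - σ) * α01 + σ * h0) + τ * (σ + (1 - σ) * α01)) / ((1 - τ) * ((1 - σ) * α01 + σ * α11) + τ * (σ + (1 - σ) * α01))) ^ lW →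
    (c0 + τ * (1 - σ) * ((1 - s) * α00 + s * 1) + s * (1 - τ) * ((1 - σ) * α01 + σ * h0)) ≤ g * (α00 / α00) ^ ly * (1 / α01) ^ lk * (α01 / α01) ^ lg * (h0 / α11) ^ lh * (((1 - s) * α00 + s * 1) / ((1 - s) * α00 + s * α01)) ^ lX * (((1 - σ) * α01 + σ * h0) / ((1 - σ) * α01 + σ * α11)) ^ lH * (((1 - τ) * ((1 - σ) * α01 + σ * h0) + τ * (σ + (1 - σ) * 1)) / ((1 - τ) * ((1 - σ) * α01 + σ * α11) + τ * (σ + (1 - σ) * α01))) ^ lW →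
    (c0 + τ * (1 - σ) * ((1 - s) * 1 + s * 1) + s * (1 - τ) * ((1 - σ) * α01 + σ * h0)) ≤ g * (1 / α00) ^ ly * (1 / α01) ^ lk * (α01 / α01) ^ lg * (h0 / α11) ^ lh * (((1 - s) * 1 + s * 1) / ((1 - s) * α00 + s * α01)) ^ lX * (((1 - σ) * α01 + σ * h0) / ((1 - σ) * α01 + σ * α11)) ^ lH * (((1 - τ) * ((1 - σ) * α01 + σ * h0) + τ * (σ + (1 - σ) * 1)) / ((1 - τ) * ((1 - σ) * α01 + σ * α11) + τ * (σ + (1 - σ) * α01))) ^ lW →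
    ∀ y k : ℝ, α00 ≤ y → y ≤ k → α01 ≤ k → k ≤ 1 → (c0 + τ * (1 - σ) * ((1 - s) * y + s * k) + s * (1 - τ) * ((1 - σ) * α01 + σ * h0)) ≤ g * (y / α00) ^ ly * (k / α01) ^ lk * (α01 / α01) ^ lg * (h0 / α11) ^ lh * (((1 - s) * y + s * k) / ((1 - s) * α00 + s * α01)) ^ lX * (((1 - σ) * α01 + σ * h0) / ((1 - σ) * α01 + σ * α11)) ^ lH * (((1 - τ) * ((1 - σ) * α01 + σ * h0) + τ * (σ + (1 - σ) * k)) / ((1 - τ) * ((1 - σ) * α01 + σ * α11) + τ * (σ + (1 - σ) * α01))) ^ lW := by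
  obtain ⟨hτ0, hτ1, hσ0, hσ1, hs0, hs1, hα00, h01, h11, hα1, hc0, hly, hlk, hlg, hlh, hlX, hlH, hlW, hg⟩ := id hP
  have hα01 : 0 < α01 := lt_of_lt_of_le hα00 h01
  have hα11 : 0 < α11 := lt_of_lt_of_le hα01 h11
  have h1σ : 0 < 1 - σ := sub_pos.2 hσ1
  have h1s : 0 < 1 - s := sub_pos.2 hs1
  intro h0 hh0 hh1 hrow e00 e10 e01 e11 y k hy hyk hk hk1
  have hα01_1 : α01 ≤ 1 := h11.trans hα1
  have ehi : (c0 + τ * (1 - σ) * ((1 - s) * y + s * 1) + s * (1 - τ) * ((1 - σ) * α01 + σ * h0)) ≤ g * (y / α00) ^ ly * (1 / α01) ^ lk * (α01 / α01) ^ lg * (h0 / α11) ^ lh * (((1 - s) * y + s * 1) / ((1 - s) * α00 + s * α01)) ^ lX * (((1 - σ) * α01 + σ * h0) / ((1 - σ) * α01 + σ * α11)) ^ lH * (((1 - τ) * ((1 - σ) * α01 + σ * h0) + τ * (σ + (1 - σ) * 1)) / ((1 - τ) * ((1 - σ) * α01 + σ * α11) + τ * (σ + (1 - σ) * α01))) ^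 lW :=
    vfibW_y hP 1 α01 h0 1 hα01_1 (le_refl α01) hh0 e01 e11 y hy (hyk.trans hk1)
  rcases le_total y α01 with hya | hya
  · have elo : (c0 + τ * (1 - σ) * ((1 - s) * y + s * α01) + s * (1 - τ) * ((1 - σ) * α01 + σ * h0)) ≤ g * (y / α00) ^ ly * (α01 / α01) ^ lk * (α01 / α01) ^ lg * (h0 / α11) ^ lh * (((1 - s) * y + s * α01) / ((1 - s) * α00 + s * α01)) ^ lX * (((1 - σ) * α01 + σ * h0) / ((1 - σ) * α01 + σ * α11)) ^ lH * (((1 - τ) * ((1 - σ) * α01 + σ * h0) + τ * (σ + (1 - σ) * α01)) / ((1 - τ) * ((1 - σ) * α01 + σ * α11) + τ * (σ + (1 - σ) * α01))) ^ lW :=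
      vfibW_y hP α01 α01 h0 α01 (le_refl α01) (le_refl α01) hh0 e00 e10 y hy hya
    exact vfibW_k hP y α01 h0 α01 hy (le_refl α01) hh0 hα01 elo ehi k hk hk1
  · have elo : (c0 + τ * (1 - σ) * ((1 - s) * y + s * y) + s * (1 - τ) * ((1 - σ) * α01 + σ * h0)) ≤ g * (y / α00) ^ ly * (y / α01) ^ lk * (α01 / α01) ^ lg * (h0 / α11) ^ lh * (((1 - s) * y + s * y) / ((1 - s) * α00 + s * α01)) ^ lX * (((1 - σ) * α01 + σ * h0) / ((1 - σ) * α01 + σ * α11)) ^ lH * (((1 - τ) * ((1 - σ) * α01 + σ * h0) + τ * (σ + (1 - σ) * y)) / ((1 - τ) * ((1 - σ) * α01 + σ * α11) + τ * (σ + (1 - σ) * α01))) ^ lW :=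
      vfibW_yk hP α01 h0 α01 (le_refl α01) hh0 hα01 (by simpa only [mul_one] using hrow) e10 e11 y hya (hyk.trans hk1)
    exact vfibW_k hP y α01 h0 y hy (le_refl α01) hh0 (lt_of_lt_of_le hα00 hy) elo ehi k hyk hk1
/- The THREE convexity rows for the `y = k` edges (W priced): edges `(t,t,α₀₁,α₁₁)`, `(t,t,α₀₁,1)`, `(t,t,α₁₁,α₁₁)`. -/
variable (hRW : lW * ((1 - τ) * ((1 - σ) * α01 + σ * α11) + τ * σ) * ((c0 + s * (1 - τ) * ((1 - σ) * α01 + σ * α11)) + τ * (1 - σ)) ^ 2 ≤ (c0 + s * (1 - τ) * ((1 - σ) * α01 + σ * α11)) * (((1 - τ) * ((1 - σ) * α01 + σ * α11) + τ * σ) + τ * (1 - σ)) ^ 2 ∧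
      lW * ((1 - τ) * ((1 - σ) * α01 + σ * 1) + τ * σ) * ((c0 + s * (1 - τ) * ((1 - σ) * α01 + σ * 1)) + τ * (1 - σ)) ^ 2 ≤ (c0 + s * (1 - τ) * ((1 - σ) * α01 + σ * 1)) * (((1 - τ) * ((1 - σ) * α01 + σ * 1) + τ * σ) + τ * (1 - σ)) ^ 2 ∧
      lW * ((1 - τ) * ((1 - σ) * α11 + σ * α11) + τ * σ) * ((c0 + s * (1 - τ) * ((1 - σ) * α11 + σ * α11)) + τ * (1 - σ)) ^ 2 ≤ (c0 + s * (1 - τ) * ((1 - σ) * α11 + σ * α11)) * (((1 - τ) * ((1 - σ) * α11 + σ * α11) + τ * σ) + τ * (1 - σ)) ^ 2)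
include hX

/-- `(α₀₀,t,t,1)` for `t ∈ [α₀₁,1]` (h-petal ↔ H-hub). [this work] -/
theorem vtxW_kg1 : ∀ t : ℝ, α01 ≤ t → t ≤ 1 → (c0 + τ * (1 - σ) * ((1 - s) * α00 + s * t) + s * (1 - τ) * ((1 - σ) * t + σ * 1)) ≤ g * (α00 / α00) ^ ly * (t / α01) ^ lk * (t / α01) ^ lg * (1 / α11) ^ lh * (((1 - s) * α00 + s * t) / ((1 - s) * α00 + s * α01)) ^ lX * (((1 - σ) * t + σ * 1) / ((1 - σ) * α01 + σ * α11)) ^ lH * (((1 - τ) * ((1 - σ) * t + σ * 1) + τ * (σ + (1 - σ) * t)) / ((1 - τ) * ((1 - σ) * α01 + σ * α11) + τ * (σ + (1 - σ) * α01))) ^ lW := by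
  obtain ⟨hτ0, hτ1, hσ0, hσ1, hs0, hs1, hα00, h01, h11, hα1, hc0, hly, hlk, hlg, hlh, hlX, hlH, hlW, hg⟩ := id hP
  have hα01 : 0 < α01 := lt_of_lt_of_le hα00 h01
  have hα11 : 0 < α11 := lt_of_lt_of_le hα01 h11
  have h1σ : 0 < 1 - σ := sub_pos.2 hσ1
  have h1s : 0 < 1 - s := sub_pos.2 hs1
  obtain ⟨vhp, vDa, vDah, vK0, vK1, vX0, vX1, vDb, vDc, vHh, vY4, vY3, vFu⟩ := hX
  exact vfibW_kg hP 1 1 hα1 (le_refl 1) vhp vHh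

/-- `(α₀₀,t,t,α₁₁)` for `t ∈ [α₀₁,α₁₁]` (floor ↔ Db). [this work] -/
theorem vtxW_kg0 : ∀ t : ℝ, α01 ≤ t → t ≤ α11 → (c0 + τ * (1 - σ) * ((1 - s) * α00 + s * t) + s * (1 - τ) * ((1 - σ) * t + σ * α11)) ≤ g * (α00 / α00) ^ ly * (t / α01) ^ lk * (t / α01) ^ lg * (α11 / α11) ^ lh * (((1 - s) * α00 + s * t) / ((1 - s) * α00 + s * α01)) ^ lX * (((1 - σ) * t + σ * α11) / ((1 - σ) * α01 + σ * α11)) ^ lH * (((1 - τ) * ((1 - σ) * t + σ * α11) + τ * (σ + (1 - σ) * t)) / ((1 - τ) * ((1 - σ) * α01 + σ * α11) + τ * (σ + (1 - σ) * α01))) ^ lW := by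
  have hfl := vtxW_floor hP
  obtain ⟨hτ0, hτ1, hσ0, hσ1, hs0, hs1, hα00, h01, h11, hα1, hc0, hly, hlk, hlg, hlh, hlX, hlH, hlW, hg⟩ := id hP
  have hα01 : 0 < α01 := lt_of_lt_of_le hα00 h01
  have hα11 : 0 < α11 := lt_of_lt_of_le hα01 h11
  have h1σ : 0 < 1 - σ := sub_pos.2 hσ1
  have h1s : 0 < 1 - s := sub_pos.2 hs1
  obtain ⟨vhp, vDa, vDah, vK0, vK1, vX0, vX1, vDb, vDc, vHh, vY4, vY3, vFu⟩ := hX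
  exact vfibW_kg hP α11 α11 (le_refl α11) hα1 hfl vDb

/-- `(α₀₀,t,t,t)` for `t ∈ [α₁₁,1]` (Db ↔ H-hub). [this work] -/
theorem vtxW_kgh : ∀ t : ℝ, α11 ≤ t → t ≤ 1 → (c0 + τ * (1 - σ) * ((1 - s) * α00 + s * t) + s * (1 - τ) * ((1 - σ) * t + σ * t)) ≤ g * (α00 / α00) ^ ly * (t / α01) ^ lk * (t / α01) ^ lg * (t / α11) ^ lh * (((1 - s) * α00 + s * t) / ((1 - s) * α00 + s * α01)) ^ lX * (((1 - σ) * t + σ * t) / ((1 - σ) * α01 + σ * α11)) ^ lH * (((1 - τ) * ((1 - σ) * t + σ * t) + τ * (σ + (1 - σ) * t)) / ((1 - τ) * ((1 - σ) * α01 + σ * α11) + τ * (σ + (1 - σ) * α01))) ^ lW := by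
  obtain ⟨hτ0, hτ1, hσ0, hσ1, hs0, hs1, hα00, h01, h11, hα1, hc0, hly, hlk, hlg, hlh, hlX, hlH, hlW, hg⟩ := id hP
  have hα01 : 0 < α01 := lt_of_lt_of_le hα00 h01
  have hα11 : 0 < α11 := lt_of_lt_of_le hα01 h11
  have h1σ : 0 < 1 - σ := sub_pos.2 hσ1
  have h1s : 0 < 1 - s := sub_pos.2 hs1
  obtain ⟨vhp, vDa, vDah, vK0, vK1, vX0, vX1, vDb, vDc, vHh, vY4, vY3, vFu⟩ := hX
  exact vfibW_kgh hP vDb vHh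

/-- `(t,t,t,1)` for `t ∈ [α₀₁,1]` (Da+h ↔ full). [this work] -/
theorem vtxW_ykg1 : ∀ t : ℝ, α01 ≤ t → t ≤ 1 → (c0 + τ * (1 - σ) * ((1 - s) * t + s * t) + s * (1 - τ) * ((1 - σ) * t + σ * 1)) ≤ g * (t / α00) ^ ly * (t / α01) ^ lk * (t / α01) ^ lg * (1 / α11) ^ lh * (((1 - s) * t + s * t) / ((1 - s) * α00 + s * α01)) ^ lX * (((1 - σ) * t + σ * 1) / ((1 - σ) * α01 + σ * α11)) ^ lH * (((1 - τ) * ((1 - σ) * t + σ * 1) + τ * (σ + (1 - σ) * t)) / ((1 - τ) * ((1 - σ) * α01 + σ * α11) + τ * (σ + (1 - σ) * α01))) ^ lW := by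
  obtain ⟨hτ0, hτ1, hσ0, hσ1, hs0, hs1, hα00, h01, h11, hα1, hc0, hly, hlk, hlg, hlh, hlX, hlH, hlW, hg⟩ := id hP
  have hα01 : 0 < α01 := lt_of_lt_of_le hα00 h01
  have hα11 : 0 < α11 := lt_of_lt_of_le hα01 h11
  have h1σ : 0 < 1 - σ := sub_pos.2 hσ1
  have h1s : 0 < 1 - s := sub_pos.2 hs1
  obtain ⟨vhp, vDa, vDah, vK0, vK1, vX0, vX1, vDb, vDc, vHh, vY4, vY3, vFu⟩ := hX
  exact vfibW_ykg hP 1 1 hα1 (le_refl 1) vDah vFu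

/-- `(t,t,t,α₁₁)` for `t ∈ [α₀₁,α₁₁]` (Da ↔ Dc). [this work] -/
theorem vtxW_ykg0 : ∀ t : ℝ, α01 ≤ t → t ≤ α11 → (c0 + τ * (1 - σ) * ((1 - s) * t + s * t) + s * (1 - τ) * ((1 - σ) * t + σ * α11)) ≤ g * (t / α00) ^ ly * (t / α01) ^ lk * (t / α01) ^ lg * (α11 / α11) ^ lh * (((1 - s) * t + s * t) / ((1 - s) * α00 + s * α01)) ^ lX * (((1 - σ) * t + σ * α11) / ((1 - σ) * α01 + σ * α11)) ^ lH * (((1 - τ) * ((1 - σ) * t + σ * α11) + τ * (σ + (1 - σ) * t)) / ((1 - τ) * ((1 - σ) * α01 + σ * α11) + τ * (σ + (1 - σ) * α01))) ^ lW := by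
  obtain ⟨hτ0, hτ1, hσ0, hσ1, hs0, hs1, hα00, h01, h11, hα1, hc0, hly, hlk, hlg, hlh, hlX, hlH, hlW, hg⟩ := id hP
  have hα01 : 0 < α01 := lt_of_lt_of_le hα00 h01
  have hα11 : 0 < α11 := lt_of_lt_of_le hα01 h11
  have h1σ : 0 < 1 - σ := sub_pos.2 hσ1
  have h1s : 0 < 1 - s := sub_pos.2 hs1
  obtain ⟨vhp, vDa, vDah, vK0, vK1, vX0, vX1, vDb, vDc, vHh, vY4, vY3, vFu⟩ := hX
  exact vfibW_ykg hP α11 α11 (le_refl α11) hα1 vDa vDc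

/-- `(t,t,t,t)` for `t ∈ [α₁₁,1]` (Dc ↔ full). [this work] -/
theorem vtxW_all : ∀ t : ℝ, α11 ≤ t → t ≤ 1 → (c0 + τ * (1 - σ) * ((1 - s) * t + s * t) + s * (1 - τ) * ((1 - σ) * t + σ * t)) ≤ g * (t / α00) ^ ly * (t / α01) ^ lk * (t / α01) ^ lg * (t / α11) ^ lh * (((1 - s) * t + s * t) / ((1 - s) * α00 + s * α01)) ^ lX * (((1 - σ) * t + σ * t) / ((1 - σ) * α01 + σ * α11)) ^ lH * (((1 - τ) * ((1 - σ) * t + σ * t) + τ * (σ + (1 - σ) * t)) / ((1 - τ) * ((1 - σ) * α01 + σ * α11) + τ * (σ + (1 - σ) * α01))) ^ lW := by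
  obtain ⟨hτ0, hτ1, hσ0, hσ1, hs0, hs1, hα00, h01, h11, hα1, hc0, hly, hlk, hlg, hlh, hlX, hlH, hlW, hg⟩ := id hP
  have hα01 : 0 < α01 := lt_of_lt_of_le hα00 h01
  have hα11 : 0 < α11 := lt_of_lt_of_le hα01 h11
  have h1σ : 0 < 1 - σ := sub_pos.2 hσ1
  have h1s : 0 < 1 - s := sub_pos.2 hs1
  obtain ⟨vhp, vDa, vDah, vK0, vK1, vX0, vX1, vDb, vDc, vHh, vY4, vY3, vFu⟩ := hX
  exact vfibW_all hP vDc vFu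

/-- Facet `g = k ≤ h`: every petal `(y,t,t,h)`. [this work] -/
theorem vtxW_faceII : ∀ y t h : ℝ, α00 ≤ y → y ≤ t → α01 ≤ t → t ≤ h → α11 ≤ h → h ≤ 1 → (c0 + τ * (1 - σ) * ((1 - s) * y + s * t) + s * (1 - τ) * ((1 - σ) * t + σ * h)) ≤ g * (y / α00) ^ ly * (t / α01) ^ lk * (t / α01) ^ lg * (h / α11) ^ lh * (((1 - s) * y + s * t) / ((1 - s) * α00 + s * α01)) ^ lX * (((1 - σ) * t + σ * h) / ((1 - σ) * α01 + σ * α11)) ^ lH * (((1 - τ) * ((1 - σ) * t + σ * h) + τ * (σ + (1 - σ) * t)) / ((1 - τ) * ((1 - σ) * α01 + σ * α11) + τ * (σ + (1 - σ) * α01))) ^ lW := by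
  have A1 := vtxW_kg1 hP hX
  have A0 := vtxW_kg0 hP hX
  have Ad := vtxW_kgh hP hX
  have B1 := vtxW_ykg1 hP hX
  have B0 := vtxW_ykg0 hP hX
  have Bd := vtxW_all hP hX
  obtain ⟨hτ0, hτ1, hσ0, hσ1, hs0, hs1, hα00, h01, h11, hα1, hc0, hly, hlk, hlg, hlh, hlX, hlH, hlW, hg⟩ := id hP
  have hα01 : 0 < α01 := lt_of_lt_of_le hα00 h01
  have hα11 : 0 < α11 := lt_of_lt_of_le hα01 h11
  have h1σ : 0 < 1 - σ := sub_pos.2 hσ1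
  have h1s : 0 < 1 - s := sub_pos.2 hs1
  intro y t h hy hyt ht hth hh hh1
  have ht1 : t ≤ 1 := hth.trans hh1
  have eA : (c0 + τ * (1 - σ) * ((1 - s) * α00 + s * t) + s * (1 - τ) * ((1 - σ) * t + σ * h)) ≤ g * (α00 / α00) ^ ly * (t / α01) ^ lk * (t / α01) ^ lg * (h / α11) ^ lh * (((1 - s) * α00 + s * t) / ((1 - s) * α00 + s * α01)) ^ lX * (((1 - σ) * t + σ * h) / ((1 - σ) * α01 + σ * α11)) ^ lH * (((1 - τ) * ((1 - σ) * t + σ * h) + τ * (σ + (1 - σ) * t)) / ((1 - τ) * ((1 - σ) * α01 + σ * α11) + τ * (σ + (1 - σ) * α01))) ^ lW := by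
    rcases le_total t α11 with hta | hta
    · exact vfibW_h hP α00 t t α11 (le_refl α00) ht ht hα11 (A0 t ht hta) (A1 t ht ht1) h hh hh1
    · exact vfibW_h hP α00 t t t (le_refl α00) ht ht (lt_of_lt_of_le hα11 hta) (Ad t hta ht1) (A1 t ht ht1) h hth hh1
  have eB : (c0 + τ * (1 - σ) * ((1 - s) * t + s * t) + s * (1 - τ) * ((1 - σ) * t + σ * h)) ≤ g * (t / α00) ^ ly * (t / α01) ^ lk * (t / α01) ^ lg * (h / α11) ^ lh * (((1 - s) * t + s * t) / ((1 - s) * α00 + s * α01)) ^ lX * (((1 - σ) * t + σ * h) / ((1 - σ) * α01 + σ * α11)) ^ lH * (((1 - τ) * ((1 - σ) * t + σ * h) + τ * (σ + (1 - σ) * t)) / ((1 - τ) * ((1 - σ) * α01 + σ * α11) + τ * (σ + (1 - σ) * α01))) ^ lW := by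
    rcases le_total t α11 with hta | hta
    · exact vfibW_h hP t t t α11 (h01.trans ht) ht ht hα11 (B0 t ht hta) (B1 t ht ht1) h hh hh1
    · exact vfibW_h hP t t t t (h01.trans ht) ht ht (lt_of_lt_of_le hα11 hta) (Bd t hta ht1) (B1 t ht ht1) h hth hh1
  exact vfibW_y hP t t h t ht ht hh eA eB y hy hyt
include hRW

/-- Facet `g = α₀₁`: every petal `(y,k,α₀₁,h)`. [this work] -/
theorem vtxW_faceI : ∀ y k h : ℝ, α00 ≤ y → y ≤ k → α01 ≤ k → k ≤ 1 → α11 ≤ h → h ≤ 1 → (c0 + τ * (1 - σ) * ((1 - s) * y + s * k) + s * (1 - τ) * ((1 - σ) * α01 + σ * h)) ≤ g * (y / α00) ^ ly * (k / α01) ^ lk * (α01 / α01) ^ lg * (h / α11) ^ lh * (((1 - s) * y + s * k) / ((1 - s) * α00 + s * α01)) ^ lX * (((1 - σ) * α01 + σ * h) / ((1 - σ) * α01 + σ * α11)) ^ lH * (((1 - τ) * ((1 - σ) * α01 + σ * h) + τ * (σ + (1 - σ) * k)) / ((1 - τ) * ((1 - σ) * α01 + σ * α11) + τ * (σ + (1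 - σ) * α01))) ^ lW := by
  have hfl := vtxW_floor hP
  have hsq := vtxW_sq hP
  obtain ⟨hτ0, hτ1, hσ0, hσ1, hs0, hs1, hα00, h01, h11, hα1, hc0, hly, hlk, hlg, hlh, hlX, hlH, hlW, hg⟩ := id hP
  have hα01 : 0 < α01 := lt_of_lt_of_le hα00 h01
  have hα11 : 0 < α11 := lt_of_lt_of_le hα01 h11
  have h1σ : 0 < 1 - σ := sub_pos.2 hσ1
  have h1s : 0 < 1 - s := sub_pos.2 hs1
  obtain ⟨vhp, vDa, vDah, vK0, vK1, vX0, vX1, vDb, vDc, vHh, vY4, vY3, vFu⟩ := hX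
  intro y k h hy hyk hk hk1 hh hh1
  obtain ⟨r0, r1, r2⟩ := hRW
  have e0 : (c0 + τ * (1 - σ) * ((1 - s) * y + s * k) + s * (1 - τ) * ((1 - σ) * α01 + σ * α11)) ≤ g * (y / α00) ^ ly * (k / α01) ^ lk * (α01 / α01) ^ lg * (α11 / α11) ^ lh * (((1 - s) * y + s * k) / ((1 - s) * α00 + s * α01)) ^ lX * (((1 - σ) * α01 + σ * α11) / ((1 - σ) * α01 + σ * α11)) ^ lH * (((1 - τ) * ((1 - σ) * α01 + σ * α11) + τ * (σ + (1 - σ) * k)) / ((1 - τ) * ((1 - σ) * α01 + σ * α11) + τ * (σ + (1 - σ) * α01))) ^ lW := hsq α11 (le_refl α11) hα1 r0 hfl vDa vK0 vX0 y k hy hyk hk hk1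
  have e1 : (c0 + τ * (1 - σ) * ((1 - s) * y + s * k) + s * (1 - τ) * ((1 - σ) * α01 + σ * 1)) ≤ g * (y / α00) ^ ly * (k / α01) ^ lk * (α01 / α01) ^ lg * (1 / α11) ^ lh * (((1 - s) * y + s * k) / ((1 - s) * α00 + s * α01)) ^ lX * (((1 - σ) * α01 + σ * 1) / ((1 - σ) * α01 + σ * α11)) ^ lH * (((1 - τ) * ((1 - σ) * α01 + σ * 1) + τ * (σ + (1 - σ) * k)) / ((1 - τ) * ((1 - σ) * α01 + σ * α11) + τ * (σ + (1 - σ) * α01))) ^ lW := hsq 1 hα1 (le_refl 1) r1 vhp vDah vK1 vX1 y k hy hyk hk hk1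
  exact vfibW_h hP y k α01 α11 hy hk (le_refl α01) hα11 e0 e1 h hh hh1

/-- Facet `g = h ≤ k`: every petal `(y,k,t,t)`. [this work] -/
theorem vtxW_faceIII : ∀ y k t : ℝ, α00 ≤ y → y ≤ k → k ≤ 1 → α11 ≤ t → t ≤ k → (c0 + τ * (1 - σ) * ((1 - s) * y + s * k) + s * (1 - τ) * ((1 - σ) * t + σ * t)) ≤ g * (y / α00) ^ ly * (k / α01) ^ lk * (t / α01) ^ lg * (t / α11) ^ lh * (((1 - s) * y + s * k) / ((1 - s) * α00 + s * α01)) ^ lX * (((1 - σ) * t + σ * t) / ((1 - σ) * α01 + σ * α11)) ^ lH * (((1 - τ) * ((1 - σ) * t + σ * t) + τ * (σ + (1 - σ) * k)) / ((1 - τ) * ((1 - σ) * α01 + σ * α11) + τ * (σ + (1 - σ) * α01))) ^ lW := by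
  have Ad := vtxW_kgh hP hX
  have Bd := vtxW_all hP hX
  obtain ⟨hτ0, hτ1, hσ0, hσ1, hs0, hs1, hα00, h01, h11, hα1, hc0, hly, hlk, hlg, hlh, hlX, hlH, hlW, hg⟩ := id hP
  have hα01 : 0 < α01 := lt_of_lt_of_le hα00 h01
  have hα11 : 0 < α11 := lt_of_lt_of_le hα01 h11
  have h1σ : 0 < 1 - σ := sub_pos.2 hσ1
  have h1s : 0 < 1 - s := sub_pos.2 hs1
  obtain ⟨vhp, vDa, vDah, vK0, vK1, vX0, vX1, vDb, vDc, vHh, vY4, vY3, vFu⟩ := hX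
  intro y k t hy hyk hk1 ht htk
  have hk11 : α11 ≤ k := ht.trans htk
  have hk01 : α01 ≤ k := h11.trans hk11
  have c0lo : (c0 + τ * (1 - σ) * ((1 - s) * α00 + s * k) + s * (1 - τ) * ((1 - σ) * α11 + σ * α11)) ≤ g * (α00 / α00) ^ ly * (k / α01) ^ lk * (α11 / α01) ^ lg * (α11 / α11) ^ lh * (((1 - s) * α00 + s * k) / ((1 - s) * α00 + s * α01)) ^ lX * (((1 - σ) * α11 + σ * α11) / ((1 - σ) * α01 + σ * α11)) ^ lH * (((1 - τ) * ((1 - σ) * α11 + σ * α11) + τ * (σ + (1 - σ) * k)) / ((1 - τ) * ((1 - σ) * α01 + σ * α11) + τ * (σ + (1 - σ) * α01))) ^ lW :=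
    vfibW_k hP α00 α11 α11 α11 (le_refl α00) h11 (le_refl α11) hα11 vDb vY4 k hk11 hk1
  obtain ⟨r0, r1, r2⟩ := hRW
  have c0hi : (c0 + τ * (1 - σ) * ((1 - s) * k + s * k) + s * (1 - τ) * ((1 - σ) * α11 + σ * α11)) ≤ g * (k / α00) ^ ly * (k / α01) ^ lk * (α11 / α01) ^ lg * (α11 / α11) ^ lh * (((1 - s) * k + s * k) / ((1 - s) * α00 + s * α01)) ^ lX * (((1 - σ) * α11 + σ * α11) / ((1 - σ) * α01 + σ * α11)) ^ lH * (((1 - τ) * ((1 - σ) * α11 + σ * α11) + τ * (σ + (1 - σ) * k)) / ((1 - τ) * ((1 - σ) * α01 + σ * α11) + τ * (σ + (1 - σ) * α01))) ^ lW :=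
    vfibW_yk hP α11 α11 α11 h11 (le_refl α11) hα11 (by simpa only [mul_one] using r2) vDc vY3 k hk11 hk1
  have e0 : (c0 + τ * (1 - σ) * ((1 - s) * y + s * k) + s * (1 - τ) * ((1 - σ) * α11 + σ * α11)) ≤ g * (y / α00) ^ ly * (k / α01) ^ lk * (α11 / α01) ^ lg * (α11 / α11) ^ lh * (((1 - s) * y + s * k) / ((1 - s) * α00 + s * α01)) ^ lX * (((1 - σ) * α11 + σ * α11) / ((1 - σ) * α01 + σ * α11)) ^ lH * (((1 - τ) * ((1 - σ) * α11 + σ * α11) + τ * (σ + (1 - σ) * k)) / ((1 - τ) * ((1 - σ) * α01 + σ * α11) + τ * (σ + (1 - σ) * α01))) ^ lW := vfibW_y hP k α11 α11 k hk01 h11 (le_refl α11) c0lo c0hi y hy hyk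
  have e1 : (c0 + τ * (1 - σ) * ((1 - s) * y + s * k) + s * (1 - τ) * ((1 - σ) * k + σ * k)) ≤ g * (y / α00) ^ ly * (k / α01) ^ lk * (k / α01) ^ lg * (k / α11) ^ lh * (((1 - s) * y + s * k) / ((1 - s) * α00 + s * α01)) ^ lX * (((1 - σ) * k + σ * k) / ((1 - σ) * α01 + σ * α11)) ^ lH * (((1 - τ) * ((1 - σ) * k + σ * k) + τ * (σ + (1 - σ) * k)) / ((1 - τ) * ((1 - σ) * α01 + σ * α11) + τ * (σ + (1 - σ) * α01))) ^ lW := vfibW_y hP k k k k hk01 hk01 hk11 (Ad k hk11 hk1) (Bd k hk11 hk1) y hy hyk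
  exact vfibW_gh hP y k k hy hk01 e0 e1 t ht htk

/-- **Exact vertex reduction.**  Under the thirteen vertex inequalities, the six-budget certificate inequality holds for EVERY petal
`α₀₀ ≤ y ≤ k ≤ 1`, `α₀₁ ≤ g ≤ min(k,h)`, `α₁₁ ≤ h ≤ 1`. [this work] -/
theorem vertex_one_petal_W : ∀ y k gc h : ℝ, α00 ≤ y → y ≤ k → k ≤ 1 → α01 ≤ gc → gc ≤ k → gc ≤ h → α11 ≤ h → h ≤ 1 →
    (c0 + τ * (1 - σ) * ((1 - s) * y + s * k) + s * (1 - τ) * ((1 - σ) * gc + σ * h)) ≤ g * (y / α00) ^ ly * (k / α01) ^ lk * (gc / α01) ^ lg * (h / α11) ^ lh * (((1 - s) * y + s * k) / ((1 - s) * α00 + s * α01)) ^ lX * (((1 - σ) * gc + σ * h) / ((1 - σ) * α01 + σ * α11)) ^ lH * (((1 - τ) * ((1 - σ) * gc + σ * h) + τ * (σ + (1 - σ) * k)) / ((1 - τ) * ((1 - σ) * α01 + σ * α11) + τ * (σ + (1 - σ) * α01))) ^ lW := by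
  have FI := vtxW_faceI hP hX hRW
  have FII := vtxW_faceII hP hX
  have FIII := vtxW_faceIII hP hX hRW
  obtain ⟨hτ0, hτ1, hσ0, hσ1, hs0, hs1, hα00, h01, h11, hα1, hc0, hly, hlk, hlg, hlh, hlX, hlH, hlW, hg⟩ := id hP
  have hα01 : 0 < α01 := lt_of_lt_of_le hα00 h01
  have hα11 : 0 < α11 := lt_of_lt_of_le hα01 h11
  have h1σ : 0 < 1 - σ := sub_pos.2 hσ1
  have h1s : 0 < 1 - s := sub_pos.2 hs1
  intro y k gc h hy hyk hk1 hgc hgk hgh hh hh1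
  have hk01 : α01 ≤ k := hgc.trans hgk
  rcases le_total k h with hkh | hhk
  · exact vfibW_g hP y k h k hy hk01 hh (FI y k h hy hyk hk01 hk1 hh hh1) (FII y k h hy hyk hk01 hkh hh hh1) gc hgc hgk
  · exact vfibW_g hP y k h h hy hk01 hh (FI y k h hy hyk hk01 hk1 hh hh1) (FIII y k h hy hyk hk1 hh hhk) gc hgc hgh

end VertexAssemblyW

set_option maxHeartbeats 800000 in
/-- **(RES0′) for every `n` from the vertex criterion.**  If the six-budget certificate holds at the thirteen vertices (`hX`) and the cap
condition `(1/α₀₀)^λ_y (1/α₀₁)^λ_k (1/α₀₁)^λ_g (1/α₁₁)^λ_h (1/b_Ȳ)^λ_Ȳ (1/b_H)^λ_H ≤ a/g` holds, then EVERY nonempty family of petals obeying the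
budgets `∏y ≤ α₀₀^(n−1)`, `∏k ≤ α₀₁^(n−1)`, `∏g ≤ α₀₁^(n−1)`, `∏h ≤ α₁₁^(n−1)`, `∏Ȳ ≤ b_Ȳ^(n−1)`, `∏H ≤ b_H^(n−1)` satisfies `∏ G_j ≤ g^(n−1)·a`.
(A 14-row LP in `λ`; feasible at ≈ 97 % of parameter points, memo §2.) [this work] -/
theorem res0_of_vertex_certificate_W {κ : Type*} [DecidableEq κ] {τ σ s α00 α01 α11 c0 g ly lk lg lh lX lH lW : ℝ}
    (hP : 0 < τ ∧ τ < 1 ∧ 0 < σ ∧ σ < 1 ∧ 0 < s ∧ s < 1 ∧ 0 < α00 ∧ α00 ≤ α01 ∧ α01 ≤ α11 ∧ α11 ≤ 1 ∧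
      τ * σ + (1 - τ) * (1 - s) * α00 ≤ c0 ∧ 0 ≤ ly ∧ 0 ≤ lk ∧ 0 ≤ lg ∧ 0 ≤ lh ∧ 0 ≤ lX ∧ 0 ≤ lH ∧ 0 ≤ lW ∧
      g = (c0 + τ * (1 - σ) * ((1 - s) * α00 + s * α01) + s * (1 - τ) * ((1 - σ) * α01 + σ * α11)))
    (hX : (c0 + τ * (1 - σ) * ((1 - s) * α00 + s * α01) + s * (1 - τ) * ((1 - σ) * α01 + σ * 1)) ≤ g * (α00 / α00) ^ ly * (α01 / α01) ^ lk * (α01 / α01) ^ lg * (1 / α11) ^ lh * (((1 - s) * α00 + s * α01) / ((1 - s) * α00 + s * α01)) ^ lX * (((1 - σ) * α01 + σ * 1) / ((1 - σ) * α01 + σ * α11)) ^ lH * (((1 - τ) * ((1 - σ) * α01 + σ * 1) + τ * (σ + (1 - σ) * α01)) / ((1 - τ) * ((1 - σ) * α01 + σ * α11) + τ * (σ + (1 - σ) * α01))) ^ lW ∧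
      (c0 + τ * (1 - σ) * ((1 - s) * α01 + s * α01) + s * (1 - τ) * ((1 - σ) * α01 + σ * α11)) ≤ g * (α01 / α00) ^ ly * (α01 / α01) ^ lk * (α01 / α01) ^ lg * (α11 / α11) ^ lh * (((1 - s) * α01 + s * α01) / ((1 - s) * α00 + s * α01)) ^ lX * (((1 - σ) * α01 + σ * α11) / ((1 - σ) * α01 + σ * α11)) ^ lH * (((1 - τ) * ((1 - σ) * α01 + σ * α11) + τ * (σ + (1 - σ) * α01)) / ((1 - τ) * ((1 - σ) * α01 + σ * α11) + τ * (σ + (1 - σ) * α01))) ^ lW ∧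
      (c0 + τ * (1 - σ) * ((1 - s) * α01 + s * α01) + s * (1 - τ) * ((1 - σ) * α01 + σ * 1)) ≤ g * (α01 / α00) ^ ly * (α01 / α01) ^ lk * (α01 / α01) ^ lg * (1 / α11) ^ lh * (((1 - s) * α01 + s * α01) / ((1 - s) * α00 + s * α01)) ^ lX * (((1 - σ) * α01 + σ * 1) / ((1 - σ) * α01 + σ * α11)) ^ lH * (((1 - τ) * ((1 - σ) * α01 + σ * 1) + τ * (σ + (1 - σ) * α01)) / ((1 - τ) * ((1 - σ) * α01 + σ * α11) + τ * (σ + (1 - σ) * α01))) ^ lW ∧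
      (c0 + τ * (1 - σ) * ((1 - s) * α00 + s * 1) + s * (1 - τ) * ((1 - σ) * α01 + σ * α11)) ≤ g * (α00 / α00) ^ ly * (1 / α01) ^ lk * (α01 / α01) ^ lg * (α11 / α11) ^ lh * (((1 - s) * α00 + s * 1) / ((1 - s) * α00 + s * α01)) ^ lX * (((1 - σ) * α01 + σ * α11) / ((1 - σ) * α01 + σ * α11)) ^ lH * (((1 - τ) * ((1 - σ) * α01 + σ * α11) + τ * (σ + (1 - σ) * 1)) / ((1 - τ) * ((1 - σ) * α01 + σ * α11) + τ * (σ + (1 - σ) * α01))) ^ lW ∧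
      (c0 + τ * (1 - σ) * ((1 - s) * α00 + s * 1) + s * (1 - τ) * ((1 - σ) * α01 + σ * 1)) ≤ g * (α00 / α00) ^ ly * (1 / α01) ^ lk * (α01 / α01) ^ lg * (1 / α11) ^ lh * (((1 - s) * α00 + s * 1) / ((1 - s) * α00 + s * α01)) ^ lX * (((1 - σ) * α01 + σ * 1) / ((1 - σ) * α01 + σ * α11)) ^ lH * (((1 - τ) * ((1 - σ) * α01 + σ * 1) + τ * (σ + (1 - σ) * 1)) / ((1 - τ) * ((1 - σ) * α01 + σ * α11) + τ * (σ + (1 - σ) * α01))) ^ lW ∧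
      (c0 + τ * (1 - σ) * ((1 - s) * 1 + s * 1) + s * (1 - τ) * ((1 - σ) * α01 + σ * α11)) ≤ g * (1 / α00) ^ ly * (1 / α01) ^ lk * (α01 / α01) ^ lg * (α11 / α11) ^ lh * (((1 - s) * 1 + s * 1) / ((1 - s) * α00 + s * α01)) ^ lX * (((1 - σ) * α01 + σ * α11) / ((1 - σ) * α01 + σ * α11)) ^ lH * (((1 - τ) * ((1 - σ) * α01 + σ * α11) + τ * (σ + (1 - σ) * 1)) / ((1 - τ) * ((1 - σ) * α01 + σ * α11) + τ * (σ + (1 - σ) * α01))) ^ lW ∧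
      (c0 + τ * (1 - σ) * ((1 - s) * 1 + s * 1) + s * (1 - τ) * ((1 - σ) * α01 + σ * 1)) ≤ g * (1 / α00) ^ ly * (1 / α01) ^ lk * (α01 / α01) ^ lg * (1 / α11) ^ lh * (((1 - s) * 1 + s * 1) / ((1 - s) * α00 + s * α01)) ^ lX * (((1 - σ) * α01 + σ * 1) / ((1 - σ) * α01 + σ * α11)) ^ lH * (((1 - τ) * ((1 - σ) * α01 + σ * 1) + τ * (σ + (1 - σ) * 1)) / ((1 - τ) * ((1 - σ) * α01 + σ * α11) + τ * (σ + (1 - σ) * α01))) ^ lW ∧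
      (c0 + τ * (1 - σ) * ((1 - s) * α00 + s * α11) + s * (1 - τ) * ((1 - σ) * α11 + σ * α11)) ≤ g * (α00 / α00) ^ ly * (α11 / α01) ^ lk * (α11 / α01) ^ lg * (α11 / α11) ^ lh * (((1 - s) * α00 + s * α11) / ((1 - s) * α00 + s * α01)) ^ lX * (((1 - σ) * α11 + σ * α11) / ((1 - σ) * α01 + σ * α11)) ^ lH * (((1 - τ) * ((1 - σ) * α11 + σ * α11) + τ * (σ + (1 - σ) * α11)) / ((1 - τ) * ((1 - σ) * α01 + σ * α11) + τ * (σ + (1 - σ) * α01))) ^ lW ∧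
      (c0 + τ * (1 - σ) * ((1 - s) * α11 + s * α11) + s * (1 - τ) * ((1 - σ) * α11 + σ * α11)) ≤ g * (α11 / α00) ^ ly * (α11 / α01) ^ lk * (α11 / α01) ^ lg * (α11 / α11) ^ lh * (((1 - s) * α11 + s * α11) / ((1 - s) * α00 + s * α01)) ^ lX * (((1 - σ) * α11 + σ * α11) / ((1 - σ) * α01 + σ * α11)) ^ lH * (((1 - τ) * ((1 - σ) * α11 + σ * α11) + τ * (σ + (1 - σ) * α11)) / ((1 - τ) * ((1 - σ) * α01 + σ * α11) + τ * (σ + (1 - σ) * α01))) ^ lW ∧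
      (c0 + τ * (1 - σ) * ((1 - s) * α00 + s * 1) + s * (1 - τ) * ((1 - σ) * 1 + σ * 1)) ≤ g * (α00 / α00) ^ ly * (1 / α01) ^ lk * (1 / α01) ^ lg * (1 / α11) ^ lh * (((1 - s) * α00 + s * 1) / ((1 - s) * α00 + s * α01)) ^ lX * (((1 - σ) * 1 + σ * 1) / ((1 - σ) * α01 + σ * α11)) ^ lH * (((1 - τ) * ((1 - σ) * 1 + σ * 1) + τ * (σ + (1 - σ) * 1)) / ((1 - τ) * ((1 - σ) * α01 + σ * α11) + τ * (σ + (1 - σ) * α01))) ^ lW ∧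
      (c0 + τ * (1 - σ) * ((1 - s) * α00 + s * 1) + s * (1 - τ) * ((1 - σ) * α11 + σ * α11)) ≤ g * (α00 / α00) ^ ly * (1 / α01) ^ lk * (α11 / α01) ^ lg * (α11 / α11) ^ lh * (((1 - s) * α00 + s * 1) / ((1 - s) * α00 + s * α01)) ^ lX * (((1 - σ) * α11 + σ * α11) / ((1 - σ) * α01 + σ * α11)) ^ lH * (((1 - τ) * ((1 - σ) * α11 + σ * α11) + τ * (σ + (1 - σ) * 1)) / ((1 - τ) * ((1 - σ) * α01 + σ * α11) + τ * (σ + (1 - σ) * α01))) ^ lW ∧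
      (c0 + τ * (1 - σ) * ((1 - s) * 1 + s * 1) + s * (1 - τ) * ((1 - σ) * α11 + σ * α11)) ≤ g * (1 / α00) ^ ly * (1 / α01) ^ lk * (α11 / α01) ^ lg * (α11 / α11) ^ lh * (((1 - s) * 1 + s * 1) / ((1 - s) * α00 + s * α01)) ^ lX * (((1 - σ) * α11 + σ * α11) / ((1 - σ) * α01 + σ * α11)) ^ lH * (((1 - τ) * ((1 - σ) * α11 + σ * α11) + τ * (σ + (1 - σ) * 1)) / ((1 - τ) * ((1 - σ) * α01 + σ * α11) + τ * (σ + (1 - σ) * α01))) ^ lW ∧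
      (c0 + τ * (1 - σ) * ((1 - s) * 1 + s * 1) + s * (1 - τ) * ((1 - σ) * 1 + σ * 1)) ≤ g * (1 / α00) ^ ly * (1 / α01) ^ lk * (1 / α01) ^ lg * (1 / α11) ^ lh * (((1 - s) * 1 + s * 1) / ((1 - s) * α00 + s * α01)) ^ lX * (((1 - σ) * 1 + σ * 1) / ((1 - σ) * α01 + σ * α11)) ^ lH * (((1 - τ) * ((1 - σ) * 1 + σ * 1) + τ * (σ + (1 - σ) * 1)) / ((1 - τ) * ((1 - σ) * α01 + σ * α11) + τ * (σ + (1 - σ) * α01))) ^ lW)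
    (hRW : lW * ((1 - τ) * ((1 - σ) * α01 + σ * α11) + τ * σ) * ((c0 + s * (1 - τ) * ((1 - σ) * α01 + σ * α11)) + τ * (1 - σ)) ^ 2 ≤ (c0 + s * (1 - τ) * ((1 - σ) * α01 + σ * α11)) * (((1 - τ) * ((1 - σ) * α01 + σ * α11) + τ * σ) + τ * (1 - σ)) ^ 2 ∧
      lW * ((1 - τ) * ((1 - σ) * α01 + σ * 1) + τ * σ) * ((c0 + s * (1 - τ) * ((1 - σ) * α01 + σ * 1)) + τ * (1 - σ)) ^ 2 ≤ (c0 + s * (1 - τ) * ((1 - σ) * α01 + σ * 1)) * (((1 - τ) * ((1 - σ) * α01 + σ * 1) + τ * σ) + τ * (1 - σ)) ^ 2 ∧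
      lW * ((1 - τ) * ((1 - σ) * α11 + σ * α11) + τ * σ) * ((c0 + s * (1 - τ) * ((1 - σ) * α11 + σ * α11)) + τ * (1 - σ)) ^ 2 ≤ (c0 + s * (1 - τ) * ((1 - σ) * α11 + σ * α11)) * (((1 - τ) * ((1 - σ) * α11 + σ * α11) + τ * σ) + τ * (1 - σ)) ^ 2)
    (hcap : (1 / α00) ^ ly * (1 / α01) ^ lk * (1 / α01) ^ lg * (1 / α11) ^ lh * (1 / ((1 - s) * α00 + s * α01)) ^ lX * (1 / ((1 - σ) * α01 + σ * α11)) ^ lH * (1 / ((1 - τ) * ((1 - σ) * α01 + σ * α11) + τ * (σ + (1 - σ) * α01))) ^ lW ≤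
      (c0 + τ * (1 - σ) + s * (1 - τ)) / g)
    (S : Finset κ) (hS : S.Nonempty) (y k gc h : κ → ℝ)
    (hy : ∀ j ∈ S, α00 ≤ y j) (hyk : ∀ j ∈ S, y j ≤ k j) (hk1 : ∀ j ∈ S, k j ≤ 1) (hg1 : ∀ j ∈ S, α01 ≤ gc j)
    (hgk : ∀ j ∈ S, gc j ≤ k j) (hgh : ∀ j ∈ S, gc j ≤ h j) (hh : ∀ j ∈ S, α11 ≤ h j) (hh1 : ∀ j ∈ S, h j ≤ 1)
    (hBy : ∏ j ∈ S, y j ≤ α00 ^ (S.card - 1)) (hBk : ∏ j ∈ S, k j ≤ α01 ^ (S.card - 1)) (hBg : ∏ j ∈ S, gc j ≤ α01 ^ (S.card - 1))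
    (hBh : ∏ j ∈ S, h j ≤ α11 ^ (S.card - 1))
    (hBY : ∏ j ∈ S, ((1 - s) * y j + s * k j) ≤ ((1 - s) * α00 + s * α01) ^ (S.card - 1))
    (hBH : ∏ j ∈ S, ((1 - σ) * gc j + σ * h j) ≤ ((1 - σ) * α01 + σ * α11) ^ (S.card - 1))
    (hBW : ∏ j ∈ S, ((1 - τ) * ((1 - σ) * gc j + σ * h j) + τ * (σ + (1 - σ) * k j)) ≤ ((1 - τ) * ((1 - σ) * α01 + σ * α11) + τ * (σ + (1 - σ) * α01)) ^ (S.card - 1)) :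
    ∏ j ∈ S, (c0 + τ * (1 - σ) * ((1 - s) * y j + s * k j) + s * (1 - τ) * ((1 - σ) * gc j + σ * h j)) ≤
      g ^ (S.card - 1) * (c0 + τ * (1 - σ) + s * (1 - τ)) := by
  have cert := vertex_one_petal_W hP hX hRW
  clear hX hRW
  obtain ⟨hτ0, hτ1, hσ0, hσ1, hs0, hs1, hα00, h01, h11, hα1, hc0, hly, hlk, hlg, hlh, hlX, hlH, hlW, hg⟩ := hP
  have hα01 : 0 < α01 := lt_of_lt_of_le hα00 h01
  have hα11 : 0 < α11 := lt_of_lt_of_le hα01 h11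
  have h1σ : 0 < 1 - σ := sub_pos.2 hσ1
  have h1s : 0 < 1 - s := sub_pos.2 hs1
  have h1τ : 0 < 1 - τ := sub_pos.2 hτ1
  have hp0 : 0 < τ * (1 - σ) := mul_pos hτ0 h1σ
  have hq0 : 0 < s * (1 - τ) := mul_pos hs0 h1τ
  have hα1' : α11 ≤ 1 := hα1
  have hc0' : 0 ≤ c0 := le_trans (add_nonneg (mul_nonneg hτ0.le hσ0.le) (mul_nonneg (mul_nonneg h1τ.le h1s.le) hα00.le)) hc0
  obtain ⟨bY, hbY⟩ : ∃ b, b = ((1 - s) * α00 + s * α01) := ⟨_, rfl⟩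
  obtain ⟨bH, hbH⟩ : ∃ b, b = ((1 - σ) * α01 + σ * α11) := ⟨_, rfl⟩
  have hbY0 : 0 < bY := by rw [hbY]; exact add_pos (mul_pos h1s hα00) (mul_pos hs0 hα01)
  have hbH0 : 0 < bH := by rw [hbH]; exact add_pos (mul_pos h1σ hα01) (mul_pos hσ0 hα11)
  obtain ⟨wf, hwf⟩ : ∃ b, b = ((1 - τ) * ((1 - σ) * α01 + σ * α11) + τ * (σ + (1 - σ) * α01)) := ⟨_, rfl⟩
  rw [← hwf] at hBW hcap cert
  rw [← hbY] at hBY hcap cert hg; rw [← hbH] at hBH hcap cert hg hwf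
  have hwf0 : 0 < wf := by
    rw [hwf]; exact add_pos (mul_pos h1τ hbH0) (mul_pos hτ0 (add_pos_of_pos_of_nonneg hσ0 (mul_nonneg h1σ.le hα01.le)))
  have hgpos : 0 < g := by
    rw [hg]; exact add_pos_of_nonneg_of_pos (add_nonneg hc0' (mul_nonneg hp0.le hbY0.le)) (mul_pos hq0 hbH0)
  obtain ⟨n, hn⟩ : ∃ n, n = S.card := ⟨_, rfl⟩
  rw [← hn] at hBy hBk hBg hBh hBY hBH hBW ⊢
  have hcardS : S.card = n := hn.symm
  -- usage vectors, caps, exponents as `Fin`-vectors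
  have hu1 : ∀ j ∈ S, ∀ i ∈ (Finset.univ : Finset (Fin 7)),
      1 ≤ (![y j / α00, k j / α01, gc j / α01, h j / α11, ((1 - s) * y j + s * k j) / bY,
        ((1 - σ) * gc j + σ * h j) / bH, ((1 - τ) * ((1 - σ) * gc j + σ * h j) + τ * (σ + (1 - σ) * k j)) / wf] : Fin 7 → ℝ) i := by
    intro j hj i _
    have := hy j hj; have := hyk j hj; have := hg1 j hj; have := hgk j hj; have := hgh j hj; have := hh j hj
    fin_cases i
    · show 1 ≤ y j / α00; rw [le_div_iff₀ hα00]; linarith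
    · show 1 ≤ k j / α01; rw [le_div_iff₀ hα01]; linarith
    · show 1 ≤ gc j / α01; rw [le_div_iff₀ hα01]; linarith
    · show 1 ≤ h j / α11; rw [le_div_iff₀ hα11]; linarith
    · show 1 ≤ ((1 - s) * y j + s * k j) / bY
      rw [le_div_iff₀ hbY0, hbY]; nlinarith [mul_le_mul_of_nonneg_left (hy j hj) h1s.le,
        mul_le_mul_of_nonneg_left (show α01 ≤ k j by linarith) hs0.le]
    · show 1 ≤ ((1 - σ) * gc j + σ * h j) / bH
      rw [le_div_iff₀ hbH0, hbH]; nlinarith [mul_le_mul_of_nonneg_left (hg1 j hj) h1σ.le,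
        mul_le_mul_of_nonneg_left (hh j hj) hσ0.le]
    · show 1 ≤ ((1 - τ) * ((1 - σ) * gc j + σ * h j) + τ * (σ + (1 - σ) * k j)) / wf
      rw [le_div_iff₀ hwf0, hwf, hbH]
      nlinarith [mul_le_mul_of_nonneg_left (hg1 j hj) h1σ.le, mul_le_mul_of_nonneg_left (hh j hj) hσ0.le,
        mul_le_mul_of_nonneg_left (show α01 ≤ k j by linarith) (mul_nonneg hτ0.le h1σ.le), h1τ]
  have hV0 : ∀ j ∈ S, 0 ≤ (c0 + τ * (1 - σ) * ((1 - s) * y j + s * k j) + s * (1 - τ) * ((1 - σ) * gc j + σ * h j)) / g :=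
    fun j hj => by
    apply div_nonneg _ hgpos.le
    have hy0 : 0 ≤ y j := hα00.le.trans (hy j hj)
    have hk0 : 0 ≤ k j := hy0.trans (hyk j hj)
    exact add_nonneg (add_nonneg hc0' (mul_nonneg hp0.le (add_nonneg (mul_nonneg h1s.le hy0) (mul_nonneg hs0.le hk0))))
      (mul_nonneg hq0.le (add_nonneg (mul_nonneg h1σ.le (hα01.le.trans (hg1 j hj))) (mul_nonneg hσ0.le (hα11.le.trans (hh j hj)))))
  have hcert' : ∀ j ∈ S, (c0 + τ * (1 - σ) * ((1 - s) * y j + s * k j) + s * (1 - τ) * ((1 - σ) * gc j + σ * h j)) / g ≤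
      ∏ i ∈ (Finset.univ : Finset (Fin 7)),
        ((![y j / α00, k j / α01, gc j / α01, h j / α11, ((1 - s) * y j + s * k j) / bY,
          ((1 - σ) * gc j + σ * h j) / bH, ((1 - τ) * ((1 - σ) * gc j + σ * h j) + τ * (σ + (1 - σ) * k j)) / wf] : Fin 7 → ℝ) i) ^
        ((![ly, lk, lg, lh, lX, lH, lW] : Fin 7 → ℝ) i) := by
    intro j hj
    rw [Fin.prod_univ_seven]
    show _ ≤ (y j / α00) ^ ly * (k j / α01) ^ lk * (gc j / α01) ^ lg * (h j / α11) ^ lh *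
          (((1 - s) * y j + s * k j) / bY) ^ lX * (((1 - σ) * gc j + σ * h j) / bH) ^ lH *
          (((1 - τ) * ((1 - σ) * gc j + σ * h j) + τ * (σ + (1 - σ) * k j)) / wf) ^ lW
    have hc := cert (y j) (k j) (gc j) (h j) (hy j hj) (hyk j hj) (hk1 j hj) (hg1 j hj) (hgk j hj) (hgh j hj) (hh j hj) (hh1 j hj)
    rw [div_le_iff₀ hgpos]
    calc (c0 + τ * (1 - σ) * ((1 - s) * y j + s * k j) + s * (1 - τ) * ((1 - σ) * gc j + σ * h j))
        ≤ g * (y j / α00) ^ ly * (k j / α01) ^ lk * (gc j / α01) ^ lg * (h j / α11) ^ lh *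
          (((1 - s) * y j + s * k j) / bY) ^ lX * (((1 - σ) * gc j + σ * h j) / bH) ^ lH *
          (((1 - τ) * ((1 - σ) * gc j + σ * h j) + τ * (σ + (1 - σ) * k j)) / wf) ^ lW := hc
      _ = _ := by ring
  have hpow : ∀ {b : ℝ}, 0 < b → ∀ {f : κ → ℝ}, ∏ j ∈ S, f j ≤ b ^ (n - 1) → ∏ j ∈ S, f j / b ≤ 1 / b := by
    intro b hb f hU
    rw [Finset.prod_div_distrib, Finset.prod_const, hcardS, div_le_div_iff₀ (pow_pos hb n) hb]
    have hn1 : 1 ≤ n := by rw [hn]; exact Finset.card_pos.2 hS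
    have e : b ^ n = b ^ (n - 1) * b := by rw [← pow_succ]; congr 1; omega
    rw [e]; nlinarith [mul_le_mul_of_nonneg_right hU hb.le]
  have hbudget : ∀ i ∈ (Finset.univ : Finset (Fin 7)),
      ∏ j ∈ S, (![y j / α00, k j / α01, gc j / α01, h j / α11, ((1 - s) * y j + s * k j) / bY,
          ((1 - σ) * gc j + σ * h j) / bH, ((1 - τ) * ((1 - σ) * gc j + σ * h j) + τ * (σ + (1 - σ) * k j)) / wf] : Fin 7 → ℝ) i ≤
        (![1 / α00, 1 / α01, 1 / α01, 1 / α11, 1 / bY, 1 / bH, 1 / wf] : Fin 7 → ℝ) i := by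
    intro i _
    fin_cases i
    · show ∏ j ∈ S, y j / α00 ≤ 1 / α00; exact hpow hα00 hBy
    · show ∏ j ∈ S, k j / α01 ≤ 1 / α01; exact hpow hα01 hBk
    · show ∏ j ∈ S, gc j / α01 ≤ 1 / α01; exact hpow hα01 hBg
    · show ∏ j ∈ S, h j / α11 ≤ 1 / α11; exact hpow hα11 hBh
    · show ∏ j ∈ S, ((1 - s) * y j + s * k j) / bY ≤ 1 / bY; exact hpow hbY0 hBY
    · show ∏ j ∈ S, ((1 - σ) * gc j + σ * h j) / bH ≤ 1 / bH; exact hpow hbH0 hBH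
    · show ∏ j ∈ S, ((1 - τ) * ((1 - σ) * gc j + σ * h j) + τ * (σ + (1 - σ) * k j)) / wf ≤ 1 / wf; exact hpow hwf0 hBW
  have hlam0 : ∀ i ∈ (Finset.univ : Finset (Fin 7)), 0 ≤ (![ly, lk, lg, lh, lX, lH, lW] : Fin 7 → ℝ) i := by
    intro i _; fin_cases i
    · exact hly
    · exact hlk
    · exact hlg
    · exact hlh
    · exact hlX
    · exact hlH
    · exact hlW
  have hT : ∏ i ∈ (Finset.univ : Finset (Fin 7)),
      ((![1 / α00, 1 / α01, 1 / α01, 1 / α11, 1 / bY, 1 / bH, 1 / wf] : Fin 7 → ℝ) i) ^ ((![ly, lk, lg, lh, lX, lH, lW] : Fin 7 → ℝ) i) ≤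
      (c0 + τ * (1 - σ) + s * (1 - τ)) / g := by
    rw [Fin.prod_univ_seven]
    show (1 / α00) ^ ly * (1 / α01) ^ lk * (1 / α01) ^ lg * (1 / α11) ^ lh * (1 / bY) ^ lX * (1 / bH) ^ lH * (1 / wf) ^ lW ≤ _
    exact hcap
  have main := prod_le_of_power_certificate (Finset.univ : Finset (Fin 7)) S
    (fun j => (![y j / α00, k j / α01, gc j / α01, h j / α11, ((1 - s) * y j + s * k j) / bY,
      ((1 - σ) * gc j + σ * h j) / bH, ((1 - τ) * ((1 - σ) * gc j + σ * h j) + τ * (σ + (1 - σ) * k j)) / wf] : Fin 7 → ℝ))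
    (fun j => (c0 + τ * (1 - σ) * ((1 - s) * y j + s * k j) + s * (1 - τ) * ((1 - σ) * gc j + σ * h j)) / g)
    (![1 / α00, 1 / α01, 1 / α01, 1 / α11, 1 / bY, 1 / bH, 1 / wf]) (![ly, lk, lg, lh, lX, lH, lW]) _
    hlam0 hu1 hV0 hcert' hbudget hT
  have e1 : ∏ j ∈ S, (c0 + τ * (1 - σ) * ((1 - s) * y j + s * k j) + s * (1 - τ) * ((1 - σ) * gc j + σ * h j)) / g =
      (∏ j ∈ S, (c0 + τ * (1 - σ) * ((1 - s) * y j + s * k j) + s * (1 - τ) * ((1 - σ) * gc j + σ * h j))) / g ^ n := by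
    rw [Finset.prod_div_distrib, Finset.prod_const, hcardS]
  rw [e1, div_le_div_iff₀ (pow_pos hgpos n) hgpos] at main
  have hn1 : 1 ≤ n := by rw [hn]; exact Finset.card_pos.2 hS
  have e2 : g ^ n = g ^ (n - 1) * g := by rw [← pow_succ]; congr 1; omega
  rw [e2] at main
  nlinarith [pow_pos hgpos (n - 1), main]

end Summit.CriticalPhenomena.PercolationContinuityZ3.Theorems.SunflowerPartition.SafeCalc.LinkedCurrency
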